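import Summits.AtomisticToContinuum.HydrodynamicLimit.Theses.JParityClosure
import Literature.MathematicalPhysics.KineticTheory.HardSphereEulerProofs
import HarnessLib

/-!
# Point masses and Maxwellians have isotropic central second moments (stub `stub_isotropyOfDiracOrMaxwellian`)

Helper for the line `Sketch` of the crux `JParityClosure.ParityBandClosure` (stmt-AtomisticToContinuum-17608),
sub-goal of the skeleton stub `stub_isotropyOfMaxwellDefect`.  The proved support `parityRigidity_proof`
(`JParityClosure.ParityRigidity`) leaves the limit local velocity law `m` on `ℝ³` as either a point mass `δ_u` or the
Maxwellian law `M_{1,u,θ}(v) dv`, `θ > 0`.  This file performs the elementary moment computation closing the isotropy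
step: in either case `m` is a probability measure with finite second moment, mean `u` and central second-moment
tensor `θ 𝟙` (`θ = 0` for the point mass).

* Dirac case: every integral against `δ_u` is evaluation at `u` (`integral_dirac`), so the central moments vanish.
* Maxwellian case: `M_{1,u,θ} dv = gaussMeasure u θ` (Literature `withDensity_localMaxwellian_eq_gaussMeasure`,
  the law of `u + √θ w`, `w ∼ N(0, 𝟙)`), which is Mathlib's `multivariateGaussian u (θ • 1)`
  (`gaussMeasure_eq_multivariateGaussian`); its coordinate means are `u_j` (`integral_coord_gaussMeasure`) and its
  coordinate covariances are the entries of `θ • 1` (`ProbabilityTheory.covariance_eval_multivariateGaussian`);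
  all moments are finite (Fernique, `IsGaussian.memLp_id`).

References: C. Cercignani, R. Illner, M. Pulvirenti, *The Mathematical Theory of Dilute Gases* (1994) §3.2
(moments of the Maxwellian).
-/

noncomputable section

namespace Summit.AtomisticToContinuum.HydrodynamicLimit.Theorems.ParityBandClosureIsotropy

open MeasureTheory ProbabilityTheory
open Literature.MathematicalPhysics.KineticTheory Literature.Analysis.FluidPDE

/-- **Moments of a point mass or a Maxwellian.**  If `m` is a Dirac mass `δ_u` on `ℝ³` or the Maxwellian law
`M_{1,u,θ}(v) dv` with `θ > 0`, then `m` is a probability measure, `‖v‖²` is `m`-integrable, and for some `θ' ≥ 0`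
(`θ' = 0`, resp. `θ' = θ`) and some `u` the coordinate means are `∫ v_j dm = u_j` and the central second moments are
`∫ (v_j - u_j)(v_k - u_k) dm = θ' δ_{jk}` (CIP 1994 §3.2: the Maxwellian `M_{1,u,θ}` is the density of the Gaussian
`N(u, θ𝟙)`). [folklore] -/
theorem stub_isotropyOfDiracOrMaxwellian :
    ∀ m : Measure V3, ((∃ u : V3, m = Measure.dirac u) ∨
      (∃ θ : ℝ, ∃ u : V3, 0 < θ ∧ m = volume.withDensity (fun v => ENNReal.ofReal (localMaxwellian 1 θ u v)))) →
    IsProbabilityMeasure m ∧ Integrable (fun v => ‖v‖ ^ 2) m ∧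
    ∃ θ : ℝ, 0 ≤ θ ∧ ∃ u : V3, (∀ j : Fin 3, ∫ v, v j ∂m = u j) ∧
      ∀ j k : Fin 3, ∫ v, (v j - u j) * (v k - u k) ∂m = if j = k then θ else 0 := by
  rintro m (⟨u, rfl⟩ | ⟨θ, u, hθ, rfl⟩)
  · -- the point mass `δ_u`: everything evaluates at `u`, the central moments vanish, `θ := 0`
    refine ⟨inferInstance, integrable_dirac (by simp), 0, le_rfl, u, fun j => ?_, fun j k => ?_⟩
    · exact integral_dirac (fun v : V3 => v j) u
    · rw [integral_dirac (fun v : V3 => (v j - u j) * (v k - u k)) u]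
      simp
  · -- the Maxwellian law `M_{1,u,θ} dv = gaussMeasure u θ = multivariateGaussian u (θ • 1)`
    rw [withDensity_localMaxwellian_eq_gaussMeasure hθ u]
    refine ⟨inferInstance, ?_, θ, hθ.le, u, fun j => integral_coord_gaussMeasure u hθ j, fun j k => ?_⟩
    · exact (IsGaussian.memLp_id _ 2 (by simp)).integrable_norm_pow (by norm_num)
    · have hS : (θ • (1 : Matrix (Fin 3) (Fin 3) ℝ)).PosSemidef := Matrix.PosSemidef.one.smul hθ.le
      have hcov := covariance_eval_multivariateGaussian (μ := u) hS j k
      rw [← gaussMeasure_eq_multivariateGaussian u hθ.le, covariance] at hcov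
      simp only [integral_coord_gaussMeasure u hθ] at hcov
      rw [hcov, Matrix.smul_apply, Matrix.one_apply, smul_eq_mul, mul_ite, mul_one, mul_zero]

end Summit.AtomisticToContinuum.HydrodynamicLimit.Theorems.ParityBandClosureIsotropy

end
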